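import Literature.Geometry.Lorentzian.CoordFrameComponents
import Literature.Analysis.ODE.HalfSpaceFlow
import HarnessLib

/-!
# Uhlenbeck's trick in coordinates: frames moved by `∂_t W = Ric(W)^♯` stay orthonormal

Coordinate tensor calculus (the `MetricCoord` layer) for the proof of Hamilton's maximum
principle for the curvature ODE (`Literature.Geometry.Riemannian.hamilton_maximumPrinciple_curvatureODE`;
Hamilton 1986, §4, Thm. 4.3). Hamilton 1986, §2, p. 157 ("Uhlenbeck's trick"): along the Ricci
flow `∂g/∂t = −2 Ric`, a frame moved by the ODE `∂_t e_a = Ric(e_a)^♯` stays `g(t)`-orthonormal,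
and in such a frame the evolution of the curvature loses its `Ric`-terms. This file provides, for
a smooth one-parameter family of metric components `G t` on `V × S`:

* `ricOp G y = ♯ ∘ Ric : E →L E` (`G_y(Ric^♯ v, w) = Ric_y(v, w)`, `apply_ricOp`) and its joint
  smoothness along a family (`IsMetricFamilyOn.contDiffOn_ricOp_family`);
* **existence of Uhlenbeck frames** `IsMetricFamilyOn.exists_frameODE`: on every interval
  `[a, b] ⊆ S` of length `≤ 1/(2N)`, `N` a bound for `‖Ric^♯‖`, through every frame `W₀` at any
  `τ ∈ [a, b]` there is a solution `W : ℝ → (ι → E)` of `W' = Ric^♯(W)` on `[a, b]` (forwards and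
  backwards; Mathlib's Picard–Lindelöf theorem for the linear system with the confinement
  `‖W(σ) − W₀‖ ≤ ‖W₀‖ + 1`, via the tree's `Literature.Analysis.ODE.exists_flow_mem_closedBall`);
* **Uhlenbeck's trick** `IsMetricFamilyOn.isONFrame_frameODE`: under the Ricci flow in
  coordinates `∂G/∂t = −2 Ric(G)`, a solution which is `G(τ)`-orthonormal at one time is
  `G(σ)`-orthonormal at all times of the interval (`d/dσ G_σ(W_i, W_j) = −2Ric + Ric + Ric = 0`);
* the symmetries of the components `rmComp G y W` of the curvature on a frame
  (`IsMetricOn.rmComp_antisymm₁₂/₃₄`, `rmComp_pair_comm`, `rmComp_cyclic`; O'Neill 1983, Ch. 3,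
  Prop. 3.36).

Everything is proved; no definition of `Prop` type is introduced.

## References

* R. S. Hamilton, *Four-manifolds with positive curvature operator*, J. Differential Geom. 24
  (1986) 153–179, §2, p. 157 (Uhlenbeck's trick). [Hamilton1986]
* P. Topping, *Lectures on the Ricci flow*, LMS Lecture Note Series 325, CUP 2006, §1.2.3,
  Prop. 2.5.1. [Topping2006]
* B. O'Neill, *Semi-Riemannian geometry*, Academic Press 1983, Ch. 3, Prop. 3.36. [ONeill1983]
-/

noncomputable section

set_option maxSynthPendingDepth 3

open Set Filter Metric ContinuousLinearMap Module
open scoped Topology ContDiff NNReal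

namespace Literature.Geometry.Lorentzian

namespace MetricCoord

variable {E : Type*} [NormedAddCommGroup E] [NormedSpace ℝ E]

/-! ### Symmetries of the curvature components on a frame -/

section Symmetries

variable [CompleteSpace E] {G : E → E →L[ℝ] E →L[ℝ] ℝ} {V : Set E} {y : E} {ι : Type*}

omit [CompleteSpace E] in
/-- Skew-symmetry in the first pair: `Rm(W_b,W_a,W_c,W_d) = −Rm(W_a,W_b,W_c,W_d)`.
[cite: ONeill1983, Ch. 3, Prop. 3.36 (1)] -/
theorem rmComp_antisymm₁₂ (W : ι → E) (a b c d : ι) :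
    rmComp G y W b a c d = -rmComp G y W a b c d := by
  simp [rmComp, rmForm, riemAt_swap G y (W a) (W b)]

/-- Skew-symmetry in the last pair: `Rm(W_a,W_b,W_d,W_c) = −Rm(W_a,W_b,W_c,W_d)`.
[cite: ONeill1983, Ch. 3, Prop. 3.36 (2)] -/
theorem IsMetricOn.rmComp_antisymm₃₄ (hG : IsMetricOn G V) (hy : y ∈ V) (W : ι → E) (a b c d : ι) :
    rmComp G y W a b d c = -rmComp G y W a b c d :=
  hG.apply_riemAt_swap hy (W a) (W b) (W c) (W d)

/-- Pair symmetry: `Rm(W_c,W_d,W_a,W_b) = Rm(W_a,W_b,W_c,W_d)`. [cite: ONeill1983, Ch. 3, Prop. 3.36 (4)] -/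
theorem IsMetricOn.rmComp_pair_comm (hG : IsMetricOn G V) (hy : y ∈ V) (W : ι → E) (a b c d : ι) :
    rmComp G y W c d a b = rmComp G y W a b c d :=
  (hG.apply_riemAt_pair_comm hy (W a) (W b) (W c) (W d)).symm

/-- First Bianchi identity: `Rm(a,b,c,d) + Rm(b,c,a,d) + Rm(c,a,b,d) = 0`.
[cite: ONeill1983, Ch. 3, Prop. 3.36 (3)] -/
theorem IsMetricOn.rmComp_cyclic (hG : IsMetricOn G V) (hy : y ∈ V) (W : ι → E) (a b c d : ι) :
    rmComp G y W a b c d + rmComp G y W b c a d + rmComp G y W c a b d = 0 := by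
  have h := hG.riemAt_cyclic hy (W a) (W b) (W c)
  have h' := congrArg (fun v ↦ G y v (W d)) h
  simpa only [map_add, _root_.add_apply, map_zero, _root_.zero_apply, rmComp, rmForm] using h'

end Symmetries

/-! ### The Ricci operator `Ric^♯` -/

section RicOp

variable [FiniteDimensional ℝ E] (G : E → E →L[ℝ] E →L[ℝ] ℝ)

/-- The **Ricci operator** `Ric^♯ = ♯ ∘ Ric : E →L E` of metric components at `y`
(`G_y(Ric^♯ v, w) = Ric_y(v, w)`): the velocity field `∂_t e_a = Ric(e_a)^♯` of Uhlenbeck's trick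
(Hamilton 1986, §2, p. 157). [cite: Hamilton1986, §2, p. 157] -/
def ricOp (y : E) : E →L[ℝ] E := (sharpAt G y).comp (ricAt G y)

/-- `Ric^♯ v = ♯(Ric(v, ·))`. [folklore] -/
theorem ricOp_apply (y v : E) : ricOp G y v = sharpAt G y (ricAt G y v) := rfl

variable {G}

/-- `G(Ric^♯ v, w) = Ric(v, w)`. [cite: Hamilton1986, §2, p. 157] -/
theorem apply_ricOp {y : E} (hy : (G y).IsInvertible) (v w : E) : G y (ricOp G y v) w = ricAt G y v w :=
  apply_sharpAt_apply hy _ w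

variable [CompleteSpace E] {S : Set ℝ} {V : Set E}

/-- `(y, t) ↦ Ric_t(y)` is `C^∞` on `V × S` along a smooth family (a private copy of
`IsMetricFamilyOn.contDiffOn_ricAt_family` of `CoordEnergyEvolution.lean`, whose measure-theoretic
imports are not wanted here). [cite: Topping2006, §1.2.3] -/
private theorem IsMetricFamilyOn.contDiffOn_ricAt_family' {G : ℝ → E → E →L[ℝ] E →L[ℝ] ℝ}
    (hG : IsMetricFamilyOn G S V) :
    ContDiffOn ℝ ∞ (fun q : E × ℝ ↦ ricAt (G q.2) q.1) (V ×ˢ S) := by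
  set b := Module.finBasis ℝ E
  refine contDiffOn_clm_apply.2 fun Y ↦ contDiffOn_clm_apply.2 fun Z ↦ ?_
  have heq : (fun q : E × ℝ ↦ ricAt (G q.2) q.1 Y Z) =
      fun q ↦ ∑ i, coordCLM b i (riemAt (G q.2) q.1 (b i) Y Z) :=
    funext fun q ↦ ricAt_eq_sum_coord b Y Z
  rw [heq]
  exact ContDiffOn.sum fun i _ ↦ (coordCLM b i).contDiff.comp_contDiffOn
    ((hG.contDiffOn_riemAt_family (b i) Y).clm_apply contDiffOn_const)

/-- `(y, t) ↦ Ric^♯_t(y)` is `C^∞` on `V × S` along a smooth family. [cite: Topping2006, §1.2.3] -/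
theorem IsMetricFamilyOn.contDiffOn_ricOp_family {G : ℝ → E → E →L[ℝ] E →L[ℝ] ℝ}
    (hG : IsMetricFamilyOn G S V) :
    ContDiffOn ℝ ∞ (fun q : E × ℝ ↦ ricOp (G q.2) q.1) (V ×ˢ S) :=
  hG.contDiffOn_sharpAt_family.clm_comp hG.contDiffOn_ricAt_family'

/-- For fixed `y ∈ V`, `σ ↦ Ric^♯_σ(y)` is continuous on `S`. [folklore] -/
theorem IsMetricFamilyOn.continuousOn_ricOp {G : ℝ → E → E →L[ℝ] E →L[ℝ] ℝ}
    (hG : IsMetricFamilyOn G S V) {y : E} (hy : y ∈ V) :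
    ContinuousOn (fun σ ↦ ricOp (G σ) y) S :=
  hG.contDiffOn_ricOp_family.continuousOn.comp (continuous_const.prodMk continuous_id).continuousOn
    fun _ hσ ↦ ⟨hy, hσ⟩

end RicOp

/-! ### Uhlenbeck frames: existence and preservation of orthonormality -/

namespace IsMetricFamilyOn

variable [FiniteDimensional ℝ E] [CompleteSpace E] {ι : Type*} [Fintype ι]
  {G : ℝ → E → E →L[ℝ] E →L[ℝ] ℝ} {S : Set ℝ} {V : Set E} {y : E}

/-- **Existence of Uhlenbeck frames** (solutions of the linear system `W'_i = Ric^♯_σ(y) W_i` in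
`ι → E`). Let `N` bound `‖Ric^♯_σ(y)‖` for `σ ∈ S` and let `[a, b] ⊆ S` have length
`N (b − a) ≤ 1/2`. Then through every frame `W₀` at every `τ ∈ [a, b]` there is a solution on
`[a, b]` with `‖W(σ) − W₀‖ ≤ ‖W₀‖ + 1` (Picard–Lindelöf for the linear field, which is
`N`-Lipschitz and continuous in `σ`). [cite: Hamilton1986, §2, p. 157] -/
theorem exists_frameODE (hG : IsMetricFamilyOn G S V) (hy : y ∈ V) {N : ℝ} (hN0 : 0 ≤ N)
    (hN : ∀ σ ∈ S, ‖ricOp (G σ) y‖ ≤ N) {a b : ℝ} (hsub : Icc a b ⊆ S)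
    (hlen : N * (b - a) ≤ 1 / 2) {τ : ℝ} (hτ : τ ∈ Icc a b) (W₀ : ι → E) :
    ∃ W : ℝ → ι → E, W τ = W₀ ∧
      (∀ σ ∈ Icc a b, HasDerivWithinAt W (fun i ↦ ricOp (G σ) y (W σ i)) (Icc a b) σ) ∧
      ∀ σ ∈ Icc a b, ‖W σ - W₀‖ ≤ ‖W₀‖ + 1 := by
  -- the constants of the Picard–Lindelöf structure
  set aB : ℝ≥0 := ⟨‖W₀‖ + 1, by positivity⟩ with haB
  set LB : ℝ≥0 := ⟨N * (‖W₀‖ + (‖W₀‖ + 1)), by positivity⟩ with hLB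
  set KB : ℝ≥0 := ⟨N, hN0⟩ with hKB
  set f : ℝ → (ι → E) → (ι → E) := fun σ W ↦ fun i ↦ ricOp (G σ) y (W i) with hf
  have hPL : IsPicardLindelof f (⟨τ, hτ⟩ : Icc a b) W₀ aB 0 LB KB := by
    refine ⟨fun σ hσ ↦ ?_, fun W _ ↦ ?_, fun σ hσ W hW ↦ ?_, ?_⟩
    · -- Lipschitz in the frame
      refine LipschitzOnWith.of_dist_le_mul fun W _ W' _ ↦ ?_
      rw [dist_eq_norm, dist_eq_norm]
      refine (pi_norm_le_iff_of_nonneg (by positivity)).2 fun i ↦ ?_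
      calc ‖(f σ W - f σ W') i‖ = ‖ricOp (G σ) y (W i - W' i)‖ := by simp [hf, map_sub]
        _ ≤ ‖ricOp (G σ) y‖ * ‖W i - W' i‖ := le_opNorm _ _
        _ ≤ N * ‖W - W'‖ := by
            refine mul_le_mul (hN σ (hsub hσ)) ?_ (norm_nonneg _) hN0
            exact norm_le_pi_norm (W - W') i
        _ = (KB : ℝ) * ‖W - W'‖ := rfl
    · -- continuity in time
      refine continuousOn_pi.2 fun i ↦ ?_
      exact ((hG.continuousOn_ricOp hy).mono hsub).clm_apply continuousOn_const
    · -- bound on the ball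
      have hWn : ‖W‖ ≤ ‖W₀‖ + (‖W₀‖ + 1) := by
        have h' := mem_closedBall.1 hW
        rw [dist_eq_norm] at h'
        have h'' : ‖W - W₀‖ ≤ ‖W₀‖ + 1 := h'
        calc ‖W‖ = ‖(W - W₀) + W₀‖ := by rw [sub_add_cancel]
          _ ≤ ‖W - W₀‖ + ‖W₀‖ := norm_add_le _ _
          _ ≤ (‖W₀‖ + 1) + ‖W₀‖ := by gcongr
          _ = ‖W₀‖ + (‖W₀‖ + 1) := by ring
      show ‖f σ W‖ ≤ N * (‖W₀‖ + (‖W₀‖ + 1))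
      refine (pi_norm_le_iff_of_nonneg (by positivity)).2 fun i ↦ ?_
      calc ‖f σ W i‖ = ‖ricOp (G σ) y (W i)‖ := rfl
        _ ≤ ‖ricOp (G σ) y‖ * ‖W i‖ := le_opNorm _ _
        _ ≤ N * ‖W‖ := mul_le_mul (hN σ (hsub hσ)) (norm_le_pi_norm W i) (norm_nonneg _) hN0
        _ ≤ N * (‖W₀‖ + (‖W₀‖ + 1)) := by gcongr
    · -- length of the interval
      have hmax : max (b - τ) (τ - a) ≤ b - a := max_le (by linarith [hτ.1]) (by linarith [hτ.2])
      have hLpos : 0 ≤ N * (‖W₀‖ + (‖W₀‖ + 1)) := by positivity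
      have h1 : N * (‖W₀‖ + (‖W₀‖ + 1)) * max (b - τ) (τ - a) ≤ ‖W₀‖ + 1 := by
        calc N * (‖W₀‖ + (‖W₀‖ + 1)) * max (b - τ) (τ - a)
            ≤ N * (‖W₀‖ + (‖W₀‖ + 1)) * (b - a) := by gcongr
          _ = (‖W₀‖ + (‖W₀‖ + 1)) * (N * (b - a)) := by ring
          _ ≤ (‖W₀‖ + (‖W₀‖ + 1)) * (1 / 2) := by gcongr
          _ ≤ ‖W₀‖ + 1 := by linarith [norm_nonneg W₀]
      show (LB : ℝ) * max (b - τ) (τ - a) ≤ (aB : ℝ) - ((0 : ℝ≥0) : ℝ)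
      rw [NNReal.coe_zero, sub_zero]
      exact h1
  obtain ⟨Wf, hWf⟩ := Literature.Analysis.ODE.exists_flow_mem_closedBall hPL
  obtain ⟨hW0, hWd, hWb⟩ := hWf W₀ (mem_closedBall_self le_rfl)
  refine ⟨Wf W₀, hW0, hWd, fun σ _ ↦ ?_⟩
  have h' := hWb σ
  rw [mem_closedBall, dist_eq_norm] at h'
  exact h'

omit [Fintype ι] in
/-- **Uhlenbeck's trick** (Hamilton 1986, §2, p. 157): under the Ricci flow in coordinates
`∂G/∂t = −2 Ric(G)`, a frame moved by `W'_i = Ric^♯(W_i)` on `[a, b] ⊆ S` which is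
`G(τ, y)`-orthonormal at one time `τ ∈ [a, b]` is `G(σ, y)`-orthonormal at every `σ ∈ [a, b]`:
`d/dσ G_σ(W_i, W_j) = −2 Ric(W_i,W_j) + Ric(W_i,W_j) + Ric(W_j,W_i) = 0`. [cite: Hamilton1986, §2, p. 157] -/
theorem isONFrame_frameODE [DecidableEq ι] (hG : IsMetricFamilyOn G S V)
    (hfl : ∀ s ∈ S, ∀ x ∈ V, tDeriv G S s x = (-2 : ℝ) • ricAt (G s) x) (hy : y ∈ V) {a b : ℝ}
    (hsub : Icc a b ⊆ S) {W : ℝ → ι → E}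
    (hW : ∀ σ ∈ Icc a b, HasDerivWithinAt W (fun i ↦ ricOp (G σ) y (W σ i)) (Icc a b) σ)
    {τ : ℝ} (hτ : τ ∈ Icc a b) (h0 : IsONFrame (G τ y) (W τ)) :
    ∀ σ ∈ Icc a b, IsONFrame (G σ y) (W σ) := by
  intro σ hσ i j
  -- the pairing `q(s) = G_s(W_i(s), W_j(s))` has zero derivative within `[a, b]`
  set q : ℝ → ℝ := fun s ↦ G s y (W s i) (W s j) with hq
  have hderiv : ∀ s ∈ Icc a b, HasDerivWithinAt q 0 (Icc a b) s := by
    intro s hs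
    have hsS : s ∈ S := hsub hs
    have hGs := (hG.hasDerivWithinAt hy hsS).mono hsub
    have hWi : HasDerivWithinAt (fun σ ↦ W σ i) (ricOp (G s) y (W s i)) (Icc a b) s :=
      hasDerivWithinAt_pi.1 (hW s hs) i
    have hWj : HasDerivWithinAt (fun σ ↦ W σ j) (ricOp (G s) y (W s j)) (Icc a b) s :=
      hasDerivWithinAt_pi.1 (hW s hs) j
    have h := (hGs.clm_apply hWi).clm_apply hWj
    refine h.congr_deriv ?_
    have hinv := (hG.isMetricOn s hsS).isInvertible y hy
    have hsy := (hG.isMetricOn s hsS).symm y hy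
    rw [hfl s hsS y hy]
    simp only [_root_.add_apply, _root_.smul_apply, smul_eq_mul]
    rw [apply_ricOp hinv, hsy (W s i) (ricOp (G s) y (W s j)), apply_ricOp hinv,
      (hG.isMetricOn s hsS).ricAt_comm hy (W s j) (W s i)]
    ring
  have hdiff : DifferentiableOn ℝ q (Icc a b) := fun s hs ↦ (hderiv s hs).differentiableWithinAt
  have hconst := constant_of_derivWithin_zero hdiff fun s hs ↦
    (hderiv s (Ico_subset_Icc_self hs)).derivWithin (uniqueDiffOn_Icc (hs.1.trans_lt hs.2) s
      (Ico_subset_Icc_self hs))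
  have h1 : q σ = q τ := by rw [hconst σ hσ, hconst τ hτ]
  simpa [hq] using h1.trans (h0 i j)

omit [CompleteSpace E] in
/-- A solution of the frame system moves at speed at most `N (2‖W₀‖ + 1)` and therefore
`‖W(σ) − W(σ')‖ ≤ N (2‖W₀‖ + 1) |σ − σ'|` on the interval. [cite: Hamilton1986, §3, Lemma 3.2] -/
theorem norm_frameODE_sub_le {N : ℝ} (hN0 : 0 ≤ N)
    (hN : ∀ σ ∈ S, ‖ricOp (G σ) y‖ ≤ N) {a b : ℝ} (hsub : Icc a b ⊆ S) {W : ℝ → ι → E} {W₀ : ι → E}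
    (hW : ∀ σ ∈ Icc a b, HasDerivWithinAt W (fun i ↦ ricOp (G σ) y (W σ i)) (Icc a b) σ)
    (hWb : ∀ σ ∈ Icc a b, ‖W σ - W₀‖ ≤ ‖W₀‖ + 1) {s s' : ℝ} (hs : s ∈ Icc a b) (hs' : s' ∈ Icc a b)
    (hss' : s ≤ s') : ‖W s' - W s‖ ≤ N * (2 * ‖W₀‖ + 1) * (s' - s) := by
  have hbound : ∀ σ ∈ Ico s s', ‖(fun i ↦ ricOp (G σ) y (W σ i))‖ ≤ N * (2 * ‖W₀‖ + 1) := by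
    intro σ hσ
    have hσab : σ ∈ Icc a b := ⟨hs.1.trans hσ.1, hσ.2.le.trans hs'.2⟩
    have hWn : ‖W σ‖ ≤ 2 * ‖W₀‖ + 1 := by
      calc ‖W σ‖ = ‖(W σ - W₀) + W₀‖ := by rw [sub_add_cancel]
        _ ≤ ‖W σ - W₀‖ + ‖W₀‖ := norm_add_le _ _
        _ ≤ (‖W₀‖ + 1) + ‖W₀‖ := by gcongr; exact hWb σ hσab
        _ = 2 * ‖W₀‖ + 1 := by ring
    refine (pi_norm_le_iff_of_nonneg (by positivity)).2 fun i ↦ ?_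
    calc ‖ricOp (G σ) y (W σ i)‖ ≤ ‖ricOp (G σ) y‖ * ‖W σ i‖ := le_opNorm _ _
      _ ≤ N * ‖W σ‖ := mul_le_mul (hN σ (hsub hσab)) (norm_le_pi_norm (W σ) i) (norm_nonneg _) hN0
      _ ≤ N * (2 * ‖W₀‖ + 1) := by gcongr
  have hsub' : Icc s s' ⊆ Icc a b := Icc_subset_Icc hs.1 hs'.2
  have key := norm_image_sub_le_of_norm_deriv_le_segment' (fun σ hσ ↦ (hW σ (hsub' hσ)).mono hsub')
    hbound s' (right_mem_Icc.2 hss')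
  exact key

end IsMetricFamilyOn

end MetricCoord

end Literature.Geometry.Lorentzian

end
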